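import Literature.Probability.RandomPlanarGeometry.SLERestrictionProcesses
import Literature.Probability.RandomPlanarGeometry.SLERestrictionStepAlive
import Literature.Probability.RandomPlanarGeometry.SLEKappaRhoFlow
import HarnessLib

/-!
# The conditional one-step estimate for the restriction martingale ([LSW] Prop. 5.2/5.3, `κ = 8/3`)

The probabilistic core of the martingale property of `Y_t = Φ'_{A_t}(W_t)^{5/8}` at `κ = 8/3`,
in conditional-increment form: for `u ≥ 0`, a small step `h`, and an `𝓕_u`-measurable weight
`g : Ω → [0, 1]` supported where the slid hull `A_u - W_u` is in the controlled class
(`Φ' ≥ δ₀`, `B(0, 8ρ₀)` off the hull),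

  `|E[g · (Ŷ_{u+h} - Y_u)]| ≤ stepC δ₀ ρ₀ · h √h`        (`abs_integral_mul_sub_le`)

where `Ŷ_{u+h} = (Φ'_{A_{u+h} - W_{u+h}}(0) 𝟙{alive at u+h})^{5/8}`. Proof: freeze the past at time
`u` (`integral_mul_eq_integral_integral_concat`, after factoring `g` through the stopped path by
Doob–Dynkin); conditionally on the past the future driver is `W_u +` a fresh `√(8/3)·B`, the hulls
do not reach `A` during the step when the fresh driver oscillates little (`SLERestrictionStepAlive`)
and then `A_{u+h} - W_{u+h}` is the one-step image of `A_u - W_u` (`slidHull_add`, locality of the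
Loewner flow in the driver); so the conditional increment is the deterministic-hull expectation
bounded in `SLERestrictionOneStep` (`abs_integral_sub_le_of_eqOn_good`).

## References

* G. F. Lawler, O. Schramm, W. Werner, *Conformal restriction: the chordal case* (2003),
  Prop. 5.2, Prop. 5.3 [LawlerSchrammWerner2003Restriction].
-/

noncomputable section

open Set Filter Metric Function MeasureTheory ProbabilityTheory
open _root_.Complex _root_.Topology
open Literature.Probability.Process (brownian preWienerMeasure runSup)
open scoped NNReal

namespace Literature.Probability.RandomPlanarGeometry

open Loewner PathOps

/-! ### Locality of hulls in the driver -/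

namespace Loewner

variable {W U : ℝ≥0 → ℝ} {A : Set ℂ} {t : ℝ≥0}

/-- **Closed hulls up to `t` only depend on the driver up to `t`.** [cite: Lawler2005, Ch. 4 §4.1] -/
theorem closedHull_eq_of_eqOn (hW : Continuous W) (hU : Continuous U) (heq : ∀ s, s ≤ t → W s = U s) :
    closedHull W t = closedHull U t := by
  ext z
  simp only [closedHull, mem_setOf_eq]
  refine and_congr_right fun _ ↦ ?_
  rw [← not_lt, ← not_lt, not_iff_not]
  exact ⟨coe_lt_swallowingTime_of_eqOn hW hU heq, coe_lt_swallowingTime_of_eqOn hU hW fun s hs ↦ (heq s hs).symm⟩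

/-- **Slid hulls up to `t` only depend on the driver up to `t`** (all of `A` alive).
[cite: Lawler2005, Ch. 4 §4.1] -/
theorem slidHull_eq_of_eqOn (hW : Continuous W) (hU : Continuous U) (heq : ∀ s, s ≤ t → W s = U s)
    (hA : ∀ a ∈ A, (t : WithTop ℝ≥0) < swallowingTime W a) : slidHull U A t = slidHull W A t := by
  ext w
  simp only [mem_slidHull_iff]
  constructor
  · rintro ⟨a, ha, rfl⟩
    exact ⟨a, ha, by rw [map_eq_of_eqOn hW hU heq (hA a ha) le_rfl, heq t le_rfl]⟩
  · rintro ⟨a, ha, rfl⟩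
    exact ⟨a, ha, by rw [map_eq_of_eqOn hW hU heq (hA a ha) le_rfl, heq t le_rfl]⟩

end Loewner

/-! ### The driver of a concatenated path -/

section Concat

variable {u : ℝ≥0}

/-- Up to time `u` the concatenated path has the driver of the first path. [folklore] -/
theorem drv_concat_of_le (p q : C(ℝ≥0, ℝ)) {r : ℝ≥0} (hr : r ≤ u) : drv (concat u (p, q)) r = drv p r := by
  have h0 : concat u (p, q) 0 = p 0 := concat_apply_of_le u p q bot_le
  simp only [drv, concat_apply_of_le u p q hr, h0]

/-- After `u` the driver increments of the concatenated path are `σ` times the second path (started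
at `0`). [folklore] -/
theorem drv_concat_add_sub (p q : C(ℝ≥0, ℝ)) (hq : q 0 = 0) (r : ℝ≥0) :
    drv (concat u (p, q)) (u + r) - drv (concat u (p, q)) u = stepSigma * q r := by
  have h1 := concat_apply_add u p q hq r
  have h0 : concat u (p, q) u = p u := concat_apply_of_le u p q le_rfl
  simp only [drv]
  rw [h1, h0]; ring

/-- The shifted driver of `concat_u(p, β(ω₂))` is the SLE_{8/3} driver of `ω₂`. [folklore] -/
theorem shift_drv_concat_brownianCPath (p : C(ℝ≥0, ℝ)) (ω₂ : ℝ≥0 → ℝ) :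
    (fun r ↦ drv (concat u (p, brownianCPath ω₂)) (u + r) - drv (concat u (p, brownianCPath ω₂)) u) = stepDriver ω₂ := by
  funext r
  rw [drv_concat_add_sub p _ (brownianCPath_zero ω₂), stepDriver_apply, brownianCPath_apply]

end Concat

/-! ### Identification of the frozen step on the good event -/

section Frozen

variable {A : Set ℂ} (hA : IsStarHull A) {u h : ℝ≥0} {p : C(ℝ≥0, ℝ)} {δ₀ ρ₀ : ℝ}
  (halive : Disjoint (closedHull (drv p) u) A) (hρ₀ : 0 < ρ₀) (hρ1 : ρ₀ ≤ 1)
  (hBρ : Disjoint (ball (0 : ℂ) (8 * ρ₀)) (slidHull (drv p) A u))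
  (hδ0 : 0 < δ₀) (hδ1 : δ₀ ≤ 1) (hh0 : 0 < h) (hh : (h : ℝ) ≤ (δ₀ * ρ₀ / 4000) ^ 2 / 32)

include hρ₀ hδ0 hδ1 hh in
/-- Elementary smallness: `4√h ≤ c₀ ≤ ρ₀/4000`, `h ≤ (ρ₀/4)²`. [folklore] -/
theorem frozen_smallness : 4 * Real.sqrt h ≤ δ₀ * ρ₀ / 4000 ∧ 2 * (δ₀ * ρ₀ / 4000) ≤ ρ₀ ∧ (h : ℝ) ≤ (ρ₀ / 4) ^ 2 := by
  have hc0 : 0 < δ₀ * ρ₀ / 4000 := by positivity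
  have hc1 : δ₀ * ρ₀ / 4000 ≤ ρ₀ / 4000 := by
    rw [div_le_div_iff_of_pos_right (by norm_num)]; nlinarith
  have hh16 : (h : ℝ) ≤ (δ₀ * ρ₀ / 4000 / 4) ^ 2 := by nlinarith
  have hsqrt : Real.sqrt h ≤ δ₀ * ρ₀ / 4000 / 4 := by
    rw [Real.sqrt_le_left (by positivity)]; exact hh16
  refine ⟨by linarith, by linarith, ?_⟩
  nlinarith

include hA halive hρ₀ hBρ hδ0 hδ1 hh0 hh in
/-- **On the good event the frozen step is the deterministic one-step image**: for
`υ = concat_u(stop_u p, β(ω₂))` with `ω₂` in the good event, the hulls of `drv υ` have not reached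
`A` at `u + h` and `Φ'_{A_{u+h} - W_{u+h}}(0) 𝟙{alive} (υ) = Φ'(slidHull (√(8/3)B(ω₂)) (A_u - W_u)(p) h)`.
[cite: LawlerSchrammWerner2003Restriction, §5] -/
theorem DFn_concat_eq_of_good {ω₂ : ℝ≥0 → ℝ} (hω₂ : ω₂ ∈ goodEvent δ₀ ρ₀ h) :
    Disjoint (closedHull (drv (concat u (stop u p, brownianCPath ω₂))) (u + h)) A ∧
      DFn A (u + h) (concat u (stop u p, brownianCPath ω₂)) = starDeriv (slidHull (stepDriver ω₂) (slidHull (drv p) A u) h) := by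
  set υ := concat u (stop u p, brownianCPath ω₂) with hυ
  have hW := continuous_drv p
  have hW' := continuous_drv υ
  have heq : ∀ s, s ≤ u → drv p s = drv υ s := fun s hs ↦ by
    rw [hυ, drv_concat_of_le _ _ hs, drv_stop_of_le p hs]
  -- locality at time `u`
  have hcl : closedHull (drv υ) u = closedHull (drv p) u := (closedHull_eq_of_eqOn hW hW' heq).symm
  have halive' : Disjoint (closedHull (drv υ) u) A := by rw [hcl]; exact halive
  have hAalive : ∀ a ∈ A, (u : WithTop ℝ≥0) < swallowingTime (drv p) a := fun a ha ↦ lt_swallowingTime_of_alive hA halive ha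
  have hsl : slidHull (drv υ) A u = slidHull (drv p) A u := slidHull_eq_of_eqOn hW hW' heq hAalive
  have hBρ' : Disjoint (ball (0 : ℂ) (8 * ρ₀)) (slidHull (drv υ) A u) := by rw [hsl]; exact hBρ
  -- the shifted driver and its oscillation on the good event
  have hshift : (fun r ↦ drv υ (u + r) - drv υ u) = stepDriver ω₂ := shift_drv_concat_brownianCPath (stop u p) ω₂
  obtain ⟨h4, h2c, hh4⟩ := frozen_smallness hρ₀ hδ0 hδ1 hh
  have hω₂' : stepSigma * runSup h ω₂ ≤ δ₀ * ρ₀ / 4000 := hω₂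
  have hS : ∀ r : ℝ≥0, r ≤ h → |drv υ (u + r) - drv υ u| ≤ stepSigma * runSup h ω₂ := fun r hr ↦ by
    have := congrFun hshift r
    rw [this]; exact abs_stepDriver_le hr ω₂
  have hη : stepSize (stepSigma * runSup h ω₂) h ≤ ρ₀ := by rw [stepSize]; linarith
  refine ⟨disjoint_closedHull_add hW' hA halive' hρ₀ hBρ' hh0 hS hη hh4, ?_⟩
  have hadd := slidHull_add_eq hW' hA halive' hρ₀ hBρ' hh0 hS hη hh4
  rw [hshift, hsl] at hadd
  rw [(DFn_eq (A := A) (u + h) υ).1 (disjoint_closedHull_add hW' hA halive' hρ₀ hBρ' hh0 hS hη hh4), hadd]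

end Frozen

/-! ### The conditional one-step bound -/

/-- `stepC ≥ 0`. [folklore] -/
theorem stepC_nonneg {δ₀ ρ₀ : ℝ} (hδ0 : 0 < δ₀) (hρ₀ : 0 < ρ₀) : 0 ≤ stepC δ₀ ρ₀ := by
  have hK : 0 < stepK δ₀ ρ₀ := by rw [stepK]; positivity
  have hKc : 0 ≤ stepKcleanOf δ₀ (stepK δ₀ ρ₀) := by rw [stepKcleanOf]; positivity
  have hA1 : 0 ≤ stepA1 δ₀ ρ₀ := by rw [stepA1]; positivity
  have hA2 : 0 ≤ stepA2 δ₀ ρ₀ := by rw [stepA2]; positivity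
  rw [stepC]; positivity

section Bound

variable [MeasurableSpace C(ℝ≥0, ℝ)] [BorelSpace C(ℝ≥0, ℝ)]
variable {A : Set ℂ} (hA : IsStarHull A) (hne : A.Nonempty) {u h : ℝ≥0} {δ₀ ρ₀ : ℝ}
  (hρ₀ : 0 < ρ₀) (hρ1 : ρ₀ ≤ 1) (hδ0 : 0 < δ₀) (hδ1 : δ₀ ≤ 1) (hh0 : 0 < h) (hh : (h : ℝ) ≤ (δ₀ * ρ₀ / 4000) ^ 2 / 32)

omit [BorelSpace C(ℝ≥0, ℝ)] in
/-- **Doob–Dynkin**: an `𝓕_u`-measurable function on the Wiener space is a measurable functional of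
the stopped Brownian path. [folklore] -/
theorem exists_eq_comp_stop [BorelSpace C(ℝ≥0, ℝ)] {g : (ℝ≥0 → ℝ) → ℝ} (hg : Measurable[brownianFiltration u] g) :
    ∃ H : C(ℝ≥0, ℝ) → ℝ, Measurable H ∧ ∀ ω, g ω = H (stop u (brownianCPath ω)) := by
  rw [brownianFiltration_eq_comap] at hg
  obtain ⟨k, hk, hgk⟩ := hg.exists_eq_measurable_comp
  refine ⟨k ∘ fun υ (j : Set.Iic u) ↦ υ j, hk.comp (measurable_pi_iff.2 fun j ↦ PathOps.measurable_eval _), fun ω ↦ ?_⟩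
  rw [hgk]
  simp only [Function.comp_apply]
  congr 1
  funext j
  rw [stop_apply, brownianCPath_apply, min_eq_left (Set.mem_Iic.1 j.2)]

include hA hne hρ₀ hρ1 hδ0 hδ1 hh0 hh in
/-- **[LSW] Prop. 5.2/5.3 (`κ = 8/3`), conditional-increment form.** For an `𝓕_u`-measurable weight
`g : Ω → [0, 1]` supported where `A_u - W_u` is in the controlled class,
`|E[g · (Ŷ_{u+h} - Y_u)]| ≤ stepC δ₀ ρ₀ · h √h`, `Ŷ_{u+h} = (Φ'_{A_{u+h}-W_{u+h}}(0) 𝟙{alive})^{5/8}`,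
`Y_u = Φ'_{A_u - W_u}(0)^{5/8}`. [cite: LawlerSchrammWerner2003Restriction, Prop. 5.2 and Prop. 5.3] -/
theorem abs_integral_mul_sub_le {g : (ℝ≥0 → ℝ) → ℝ} (hgm : Measurable[brownianFiltration u] g)
    (hg01 : ∀ ω, g ω ∈ Icc (0 : ℝ) 1)
    (hsupp : ∀ ω, g ω ≠ 0 → Disjoint (closedHull (drv (brownianCPath ω)) u) A ∧
      Disjoint (ball (0 : ℂ) (8 * ρ₀)) (slidHull (drv (brownianCPath ω)) A u) ∧
        δ₀ ≤ starDeriv (slidHull (drv (brownianCPath ω)) A u)) :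
    |∫ ω, g ω * (DFn A (u + h) (brownianCPath ω) ^ (5 / 8 : ℝ) -
        starDeriv (slidHull (drv (brownianCPath ω)) A u) ^ (5 / 8 : ℝ)) ∂preWienerMeasure| ≤
      stepC δ₀ ρ₀ * h * Real.sqrt h := by
  haveI := isProbabilityMeasure_preWienerMeasure'
  set C₀ : ℝ := stepC δ₀ ρ₀ * h * Real.sqrt h with hC₀
  have hC₀0 : 0 ≤ C₀ := by rw [hC₀]; have := stepC_nonneg hδ0 hρ₀; positivity
  -- Doob–Dynkin, clipped to `[0, 1]`
  obtain ⟨H, hHm, hgH⟩ := exists_eq_comp_stop (u := u) hgm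
  set H' : C(ℝ≥0, ℝ) → ℝ := fun υ ↦ max 0 (min (H υ) 1) with hH'
  have hH'm : Measurable H' := measurable_const.max (hHm.min measurable_const)
  have hH'b : ∀ υ, |H' υ| ≤ 1 := fun υ ↦ by
    rw [abs_le]; exact ⟨by linarith [le_max_left 0 (min (H υ) 1)], max_le zero_le_one (min_le_right _ _)⟩
  have hgH' : ∀ ω, g ω = H' (stop u (brownianCPath ω)) := fun ω ↦ by
    rw [hH']; simp only
    rw [← hgH ω, min_eq_left (hg01 ω).2, max_eq_right (hg01 ω).1]
  -- the functional `J = Ŷ`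
  set J : C(ℝ≥0, ℝ) → ℝ := fun υ ↦ DFn A (u + h) υ ^ (5 / 8 : ℝ) with hJ
  have hJm : Measurable J := (measurable_DFn hA hne (u + h)).pow_const _
  have hJ01 : ∀ υ, J υ ∈ Icc (0 : ℝ) 1 := fun υ ↦ by
    obtain ⟨-, -, h0, h1⟩ := DFn_eq (A := A) (u + h) υ
    exact ⟨Real.rpow_nonneg h0 _, Real.rpow_le_one h0 h1 (by norm_num)⟩
  have hJb : ∀ υ, |J υ| ≤ 1 := fun υ ↦ by rw [abs_of_nonneg (hJ01 υ).1]; exact (hJ01 υ).2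
  -- freezing
  have hfreeze := integral_mul_eq_integral_integral_concat u hH'm hJm hH'b hJb
  set Θ : (ℝ≥0 → ℝ) → ℝ := fun ω ↦ ∫ ω₂, J (concat u (stop u (brownianCPath ω), brownianCPath ω₂)) ∂preWienerMeasure with hΘ
  set Y : (ℝ≥0 → ℝ) → ℝ := fun ω ↦ starDeriv (slidHull (drv (brownianCPath ω)) A u) ^ (5 / 8 : ℝ) with hY
  -- measurability and bounds
  have hgm' : Measurable g := hgm.mono (brownianFiltration.le u) le_rfl
  have hXm : Measurable fun ω ↦ stop u (brownianCPath ω) := (measurable_stop u).comp measurable_brownianCPath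
  have hJβ : Measurable fun ω ↦ J (brownianCPath ω) := hJm.comp measurable_brownianCPath
  have hΘm : Measurable Θ := by
    have h2 : Measurable fun q : (ℝ≥0 → ℝ) × (ℝ≥0 → ℝ) ↦ J (concat u (stop u (brownianCPath q.1), brownianCPath q.2)) :=
      hJm.comp ((measurable_concat u).comp ((hXm.comp measurable_fst).prodMk (measurable_brownianCPath.comp measurable_snd)))
    exact h2.stronglyMeasurable.integral_prod_right' |>.measurable
  have hΘ01 : ∀ ω, Θ ω ∈ Icc (0 : ℝ) 1 := fun ω ↦ by
    constructor
    · exact integral_nonneg fun ω₂ ↦ (hJ01 _).1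
    · have := integral_mono (μ := preWienerMeasure) (f := fun ω₂ ↦ J (concat u (stop u (brownianCPath ω), brownianCPath ω₂)))
        (g := fun _ ↦ (1 : ℝ)) ?_ (integrable_const _) fun ω₂ ↦ (hJ01 _).2
      · simpa using this
      · exact (integrable_const (1 : ℝ)).mono' ((hJm.comp ((measurable_concat u).comp
          (measurable_const.prodMk measurable_brownianCPath))).aestronglyMeasurable)
          (Eventually.of_forall fun ω₂ ↦ by rw [Real.norm_eq_abs]; exact hJb _)
  have hY01 : ∀ ω, Y ω ∈ Icc (0 : ℝ) 1 := fun ω ↦ by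
    obtain ⟨h0, h1⟩ := starDeriv_pos_le_one (slidHull (drv (brownianCPath ω)) A u)
    exact ⟨Real.rpow_nonneg h0.le _, Real.rpow_le_one h0.le h1 (by norm_num)⟩
  have hYm : Measurable fun ω ↦ g ω * Y ω := by
    -- `g · Y = g · (D_u)^{5/8}` where `g ≠ 0` forces alive at `u`; use the measurable `DFn A u`
    have h1 : (fun ω ↦ g ω * Y ω) = fun ω ↦ g ω * DFn A u (brownianCPath ω) ^ (5 / 8 : ℝ) := by
      funext ω
      by_cases hg0 : g ω = 0
      · rw [hg0, zero_mul, zero_mul]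
      · rw [hY]; simp only
        rw [(DFn_eq (A := A) u (brownianCPath ω)).1 (hsupp ω hg0).1]
    rw [h1]
    exact hgm'.mul (((measurable_DFn hA hne u).comp measurable_brownianCPath).pow_const _)
  have hbdd_int : ∀ {f : (ℝ≥0 → ℝ) → ℝ}, Measurable f → (∀ ω, |f ω| ≤ 1) → Integrable f preWienerMeasure := fun hf hb ↦
    (integrable_const (1 : ℝ)).mono' hf.aestronglyMeasurable (Eventually.of_forall fun ω ↦ by rw [Real.norm_eq_abs]; exact hb ω)
  have hg1 : ∀ ω, |g ω| ≤ 1 := fun ω ↦ by rw [abs_of_nonneg (hg01 ω).1]; exact (hg01 ω).2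
  have i1 : Integrable (fun ω ↦ g ω * J (brownianCPath ω)) preWienerMeasure :=
    hbdd_int (hgm'.mul hJβ) fun ω ↦ by rw [abs_mul]; exact mul_le_one₀ (hg1 ω) (abs_nonneg _) (hJb _)
  have i2 : Integrable (fun ω ↦ g ω * Y ω) preWienerMeasure :=
    hbdd_int hYm fun ω ↦ by
      rw [abs_mul, abs_of_nonneg (hY01 ω).1]; exact mul_le_one₀ (hg1 ω) (hY01 ω).1 (hY01 ω).2
  have i3 : Integrable (fun ω ↦ g ω * Θ ω) preWienerMeasure :=
    hbdd_int (hgm'.mul hΘm) fun ω ↦ by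
      rw [abs_mul, abs_of_nonneg (hΘ01 ω).1]; exact mul_le_one₀ (hg1 ω) (hΘ01 ω).1 (hΘ01 ω).2
  -- rewrite the integral through the freezing formula
  have hsplit : ∫ ω, g ω * (DFn A (u + h) (brownianCPath ω) ^ (5 / 8 : ℝ) -
      starDeriv (slidHull (drv (brownianCPath ω)) A u) ^ (5 / 8 : ℝ)) ∂preWienerMeasure =
      ∫ ω, g ω * (Θ ω - Y ω) ∂preWienerMeasure := by
    have e1 : (fun ω ↦ g ω * (DFn A (u + h) (brownianCPath ω) ^ (5 / 8 : ℝ) -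
        starDeriv (slidHull (drv (brownianCPath ω)) A u) ^ (5 / 8 : ℝ))) = fun ω ↦ g ω * J (brownianCPath ω) - g ω * Y ω := by
      funext ω; rw [hJ, hY]; ring
    have e2 : (fun ω ↦ g ω * (Θ ω - Y ω)) = fun ω ↦ g ω * Θ ω - g ω * Y ω := by funext ω; ring
    rw [e1, e2, integral_sub i1 i2, integral_sub i3 i2]
    congr 1
    have e3 : (fun ω ↦ g ω * J (brownianCPath ω)) = fun ω ↦ H' (stop u (brownianCPath ω)) * J (brownianCPath ω) := by
      funext ω; rw [hgH' ω]
    have e4 : (fun ω ↦ g ω * Θ ω) = fun ω ↦ H' (stop u (brownianCPath ω)) * Θ ω := by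
      funext ω; rw [hgH' ω]
    rw [e3, e4]
    exact hfreeze
  rw [hsplit]
  -- pointwise bound by the deterministic one-step estimate
  have hpt : ∀ ω, |g ω * (Θ ω - Y ω)| ≤ C₀ := fun ω ↦ by
    by_cases hg0 : g ω = 0
    · rw [hg0, zero_mul, abs_zero]; exact hC₀0
    · obtain ⟨halive, hBρ, hδ⟩ := hsupp ω hg0
      have hB := isStarHull_slidHull_of_disjoint (continuous_drv _) hA halive
      have hZm : Measurable fun ω₂ ↦ J (concat u (stop u (brownianCPath ω), brownianCPath ω₂)) :=
        hJm.comp ((measurable_concat u).comp (measurable_const.prodMk measurable_brownianCPath))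
      have hZeq : ∀ ω₂ ∈ goodEvent δ₀ ρ₀ h, J (concat u (stop u (brownianCPath ω), brownianCPath ω₂)) =
          starDeriv (slidHull (stepDriver ω₂) (slidHull (drv (brownianCPath ω)) A u) h) ^ (5 / 8 : ℝ) := fun ω₂ hω₂ ↦ by
        rw [hJ]; simp only
        rw [(DFn_concat_eq_of_good hA halive hρ₀ hBρ hδ0 hδ1 hh0 hh hω₂).2]
      have key := abs_integral_sub_le_of_eqOn_good hB hρ₀ hρ1 hBρ hδ0 hδ hh0 hh hZm (fun ω₂ ↦ hJ01 _) hZeq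
      rw [abs_mul]
      calc |g ω| * |Θ ω - Y ω| ≤ 1 * C₀ := mul_le_mul (hg1 ω) key (abs_nonneg _) zero_le_one
        _ = C₀ := one_mul _
  calc |∫ ω, g ω * (Θ ω - Y ω) ∂preWienerMeasure| ≤ ∫ ω, |g ω * (Θ ω - Y ω)| ∂preWienerMeasure := abs_integral_le_integral_abs
    _ ≤ ∫ _, C₀ ∂preWienerMeasure := integral_mono ((i3.sub i2).congr (Eventually.of_forall fun ω ↦ by simp only [Pi.sub_apply]; ring)).abs
        (integrable_const _) hpt
    _ = C₀ := by simp

end Bound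

end Literature.Probability.RandomPlanarGeometry
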